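import Mathlib
import Literature.AlgebraicGeometry.Resolution.VPreparedInitialLabel
import Literature.AlgebraicGeometry.Resolution.PolygonShear
import HarnessLib

/-!
# The label after the shear `u₂ ↦ u₂ + φ u₁`: re-preparation at `w⁻` keeping `v` (T1-shear)

Topic: `Literature/AlgebraicGeometry/Resolution`. One bookkeeping step of the `τ = 1` unit recursion
(Cossart–Jannsen–Saito, LNM 2270, Lemma 13.6 with Lemma 11.4; Cossart–Piltant 2008, proof of Lemma 4.5 (2),
p. 12: "we replace `(u₁, u₂, z)` by `(u₁, v₂ := u₂ + λu₁, z)`" — moving the rational near point `(1 : λ)`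
of the exceptional line to the origin of the `u₁`-chart). The tree's `PolygonShear.lean` proves that the
vertex `v = (α, β)`, `δ` and `v`-PREPAREDNESS are shear invariant; `w⁻`-preparedness is NOT (the shear
moves the points of a diagonal `x₁ + x₂ = const` toward larger `x₁`, so `γ⁻` may change), and the
point-step theorem `PointStepPrepared.exists_prepared_label_pointStep` consumes a `w⁻`-prepared adapted
label. This file re-derives it: after the shear, finitely many dissolutions at `w⁻`
(`FacePreparation.exists_wMinusPrepared`, which keep `v`, `α`, `β`, do not lower `δ`, and change `y` by
an element of `𝔪²`) give the unit-start data again. OURS (a lemma toward the printed proofs).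

PROVED (no definitions, no named facts): `exists_prepared_label_shear` — for an adapted (`L < δs`),
`v`-prepared `c = (y, u₁, u₂)` with `J ⊆ 𝔪^μ` and Newton points, and any `φ ∈ R`, there is `z ≡ y mod 𝔪²`
with `(z, u₁, u₂ + φ u₁) = 𝔪`, Newton points, the SAME `αs, βs`, `L < δs`, `VPrepared` and
`WMinusPrepared`. (`HasMonic` / "order exactly `μ`" are coordinate-free resp. follow from `L < δs` as in
`VPreparedInitialLabel`, and are not restated.)

AI-written formalization; weaker than expert review. Resolution of singularities in dimension `≥ 4` /
characteristic `p` is NOT proved here; `CossartPiltant2008_prop44` (F-71) and its `τ = 1` termination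
(T1) are NOT discharged by this file; no summit statement is proved here.

## Sources

* V. Cossart, U. Jannsen, S. Saito, LNM 2270 (2020), Lemma 13.6, Lemma 11.4, Lemma 12.1 (4).
  [CossartJannsenSaito2020]
* V. Cossart, O. Piltant, J. Algebra 320 (2008) 1051–1082, proof of Lemma 4.5 (2), p. 12.
  [CossartPiltant2008]
-/

noncomputable section

open IsLocalRing MvPolynomial

namespace Literature.AlgebraicGeometry.Resolution

universe u

variable {R : Type u} [CommRing R]

section Shear

variable [IsRegularLocalRing R] (c : Fin 3 → R)
  (hgen : Ideal.span {c 0, c 1, c 2} = maximalIdeal R) (hdim : ringKrullDim R = 3)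
  {J : Ideal R} {μ : ℕ}

include hgen hdim in
/-- **T1-shear (OURS).** For an adapted (`L < δs`), `v`-prepared label `c = (y, u₁, u₂)` with
`J ⊆ 𝔪^μ` and Newton points, and any `φ ∈ R`: there is `z ≡ y mod 𝔪²` such that
`(z, u₁, u₂ + φ u₁)` generates `𝔪`, has Newton points, the same `αs, βs`, `L < δs`, and is `v`- and
`w⁻`-prepared. [cite: CossartJannsenSaito2020, Lemma 13.6, Lemma 11.4] [cite: CossartPiltant2008, proof of Lemma 4.5 (2), p. 12] -/
theorem exists_prepared_label_shear (φ : R) (hJμ : J ≤ maximalIdeal R ^ μ)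
    (hne : (pts c J μ).Nonempty) (hδ : μ.factorial < deltaS c J μ) (hvp : VPrepared c J μ) :
    ∃ z : R, z - c 0 ∈ maximalIdeal R ^ 2 ∧
      Ideal.span {z, c 1, c 2 + φ * c 1} = maximalIdeal R ∧
      (pts ![z, c 1, c 2 + φ * c 1] J μ).Nonempty ∧
      alphaS ![z, c 1, c 2 + φ * c 1] J μ = alphaS c J μ ∧
      betaS ![z, c 1, c 2 + φ * c 1] J μ = betaS c J μ ∧
      μ.factorial < deltaS ![z, c 1, c 2 + φ * c 1] J μ ∧
      VPrepared ![z, c 1, c 2 + φ * c 1] J μ ∧ WMinusPrepared ![z, c 1, c 2 + φ * c 1] J μ := by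
  classical
  -- the sheared system: `v`, `α`, `β`, `δ` and `v`-preparedness are invariant (CJS Lemma 13.6)
  have hgen₁ : Ideal.span {shiftU₂ c φ 0, shiftU₂ c φ 1, shiftU₂ c φ 2} = maximalIdeal R := by
    rw [span_triple_shiftU₂ c φ]; exact hgen
  have hne₁ : (pts (shiftU₂ c φ) J μ).Nonempty := pts_shiftU₂_nonempty c hgen hdim φ hJμ hne
  have hα₁ : alphaS (shiftU₂ c φ) J μ = alphaS c J μ := alphaS_shiftU₂ c hgen hdim φ hJμ hne
  have hβ₁ : betaS (shiftU₂ c φ) J μ = betaS c J μ := betaS_shiftU₂ c hgen hdim φ hJμ hne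
  have hδ₁ : μ.factorial < deltaS (shiftU₂ c φ) J μ := by
    rw [deltaS_shiftU₂ c hgen hdim φ hJμ hne]; exact hδ
  have hvp₁ : VPrepared (shiftU₂ c φ) J μ := (vPrepared_shiftU₂_iff c hgen hdim φ hJμ hne).mpr hvp
  -- re-prepare at `w⁻`, keeping `v`
  obtain ⟨cs, hcs1, hcs2, hcs0, hgen', -, hne', hα', hβ', hvp', hδle, hwm⟩ :=
    exists_wMinusPrepared (hdim := hdim) (J := J) (μ := μ) (wMinusMeasure (shiftU₂ c φ) J μ)
      (shiftU₂ c φ) hgen₁ hne₁ hδ₁ hvp₁ le_rfl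
  have h0 : shiftU₂ c φ 0 = c 0 := rfl
  have h1 : cs 1 = c 1 := hcs1
  have h2 : cs 2 = c 2 + φ * c 1 := hcs2
  have hvec : cs = ![cs 0, c 1, c 2 + φ * c 1] := by
    funext i
    fin_cases i
    · rfl
    · exact h1
    · exact h2
  rw [h0] at hcs0
  refine ⟨cs 0, hcs0, ?_, ?_, ?_, ?_, ?_, ?_, ?_⟩
  · have h := hgen'
    rw [h1, h2] at h
    exact h
  · rw [← hvec]; exact hne'
  · rw [← hvec, hα', hα₁]
  · rw [← hvec, hβ', hβ₁]
  · rw [← hvec]; exact lt_of_lt_of_le hδ₁ hδle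
  · rw [← hvec]; exact hvp'
  · rw [← hvec]; exact hwm

end Shear

end Literature.AlgebraicGeometry.Resolution

end
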